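import Summits.MatrixMultiplication.MatrixMultiplication.Theorems.GradedDesignFamily.Negative.SubfieldCellNineLambdaDual

/-!
# Subfield cell `GL₂(𝔽₉) ⊃ SL₂(𝔽₃)` at level one — IIb: the pool certificate

**Honest framing.** VALUE = a kernel-checked finite certificate about ONE finite cell of
ONE skeleton line (`quadratic_extension_level_one_cell`, stub S3 `stub_subfieldCell`, crux
`GradedDesignFamily` of route `LevelGradedCohnUmans`), in the *standard model*
`(k, K, φ) = (𝔽₃, 𝔽₉, mapGL)`.  It is **not** progress on `Summit.MatrixMultiplication` (no bound on
`ω` is touched) and it does **not** refute `stub_subfieldCell`, whose quantifiers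
`∃ c > 0, ∀ N, ∃ (k, K, φ) …` are insensitive to any single cell.

## Content

For an invertible `a`, call `a` *thin* if `v_{a⁻¹}` is a cyclic shift of `v_a` (`kprop`), and let the
*pool* of `a` be the set of matrices `z` with `v_{az}` and `v_{a⁻¹z}` both cyclic shifts of `v_a`
(in file III: if `|Z| ≥ 18` then `u = y₂y₁⁻¹` is thin and `Z ⊆ pool(u)`).

**`cert_exists`:** for every thin invertible `a` one of the 21 candidate functionals `Φ ∈ cands`
is non-constant, kills `vz a` and kills `vz z` for every `z` in the pool of `a`.

The search (`fact_certC`, `native_decide`; 480 thin matrices × 6561 candidates `z`) is run on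
*integer codes* (`F9c = Fin 9` for `𝔽₉`, `MC` for matrices, `kmulF`/`kaddF`/`mulC`, table `tabA`,
`vcN`), because interpreted `𝔽₉`-arithmetic is two orders of magnitude slower; the code world is
tied back to the matrix world by the decidable facts `kF_mul`, `kF_add` (hence `mc_mul2`) and
`fact_vc : vc g i = vcN (mc g) i`.  Cross-check: the Python model `lam9.py` finds the same 480 thin
matrices and certifies all of them with the same candidate list.
-/

set_option linter.dupNamespace false

namespace Summit.MatrixMultiplication.MatrixMultiplication.Theorems.GradedDesignFamily.Negative.SubfieldNine

open Matrix

/-! ### The pool certificate, computed on integer codes -/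

/-- Codes of `𝔽₉`. -/
abbrev F9c : Type := Fin 9
/-- Codes of matrices. -/
abbrev MC : Type := F9c × F9c × F9c × F9c

/-- Codes of `𝔽₉` are `< 9`. -/
theorem kcode_lt (y : K) : kcode y < 9 := by
  have h1 := ZMod.val_lt y.re; have h2 := ZMod.val_lt y.im; unfold kcode; omega

/-- code of an element of `𝔽₉` -/
def kF (y : K) : F9c := ⟨kcode y, kcode_lt y⟩

/-- multiplication on codes -/
def kmulF (m n : F9c) : F9c :=
  ⟨((m.val % 3) * (n.val % 3) + 2 * ((m.val / 3) * (n.val / 3))) % 3 +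
    3 * (((m.val % 3) * (n.val / 3) + (m.val / 3) * (n.val % 3)) % 3), by omega⟩

/-- addition on codes -/
def kaddF (m n : F9c) : F9c := ⟨(m.val % 3 + n.val % 3) % 3 + 3 * ((m.val / 3 + n.val / 3) % 3), by omega⟩

/-- `kF` turns multiplication in `𝔽₉` into `kmulF` (exhaustive check). -/
theorem kF_mul : ∀ x y : K, kF (x * y) = kmulF (kF x) (kF y) := by native_decide
/-- `kF` turns addition in `𝔽₉` into `kaddF` (exhaustive check). -/
theorem kF_add : ∀ x y : K, kF (x + y) = kaddF (kF x) (kF y) := by native_decide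

/-- matrix code -/
def mc (g : Mat) : MC := (kF (g 0 0), kF (g 0 1), kF (g 1 0), kF (g 1 1))

/-- product on matrix codes -/
def mulC : MC → MC → MC
  | (a, b, c, d), (e, f, g, h) =>
    (kaddF (kmulF a e) (kmulF b g), kaddF (kmulF a f) (kmulF b h),
     kaddF (kmulF c e) (kmulF d g), kaddF (kmulF c f) (kmulF d h))

/-- Matrix codes are multiplicative. -/
theorem mc_mul2 (a z : Mat) : mc (mul2 a z) = mulC (mc a) (mc z) := by
  simp [mc, mulC, mul2, kF_add, kF_mul]

/-- the orbit/exponent table as an array -/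
def tabA : Array (Option (Fin 2 × ZMod 3)) := Array.ofFn fun n : Fin 81 => tabN n.val

/-- code-world compressed λ-vector -/
def vcN (c : MC) (i : Idx) : Option (ZMod 3) :=
  match c with
  | (c00, c01, c10, c11) =>
    let u0 : F9c := if i.1.val < 9 then 1 else 0
    let u1 : F9c := if h : i.1.val < 9 then ⟨i.1.val, h⟩ else 1
    let e0 := kaddF (kmulF c00 u0) (kmulF c01 u1)
    let e1 := kaddF (kmulF c10 u0) (kmulF c11 u1)
    match tabA.getD (9 * e0.val + e1.val) none with
    | none => none
    | some (O, e) => if O = i.2 then some e else none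

/-- **Bridge.** The code-world λ-vector agrees with `vc` (exhaustive check over all matrices). -/
theorem fact_vc : ∀ g : Mat, ∀ i : Idx, vc g i = vcN (mc g) i := by native_decide

/-- code-world λ-vector values -/
def vzN (c : MC) (i : Idx) : ℤ√(-3) := oval (vcN c i)

/-- the three shifts -/
def shifts : List (ZMod 3) := [0, 1, 2]

/-- Boolean cyclic-shift test -/
def kpropB (p q : Idx → Option (ZMod 3)) : Bool :=
  shifts.any fun j => allIdx.all fun i => p i == (q i).map (· + j)

/-- `allIdx` is exhaustive. -/
theorem mem_allIdx : ∀ i : Idx, i ∈ allIdx := by decide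
/-- `shifts` is exhaustive. -/
theorem mem_shifts : ∀ j : ZMod 3, j ∈ shifts := by decide

/-- `kpropB` decides `kprop`. -/
theorem kpropB_iff (p q : Idx → Option (ZMod 3)) : kpropB p q = true ↔ kprop p q := by
  simp only [kpropB, kprop, List.any_eq_true, List.all_eq_true, beq_iff_eq]
  constructor
  · rintro ⟨j, -, h⟩; exact ⟨j, fun i => h i (mem_allIdx i)⟩
  · rintro ⟨j, h⟩; exact ⟨j, mem_shifts j, fun i _ => h i⟩

/-- code-world pool test -/
def poolC (c cinv zc : MC) : Bool :=
  kpropB (vcN (mulC c zc)) (vcN c) && kpropB (vcN (mulC cinv zc)) (vcN c)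

/-- all matrix codes -/
def allMC : List MC :=
  (List.finRange 9).flatMap fun a => (List.finRange 9).flatMap fun b =>
    (List.finRange 9).flatMap fun c => (List.finRange 9).map fun d => (a, b, c, d)

/-- `allMC` is exhaustive. -/
theorem mem_allMC : ∀ c : MC, c ∈ allMC := by
  rintro ⟨a, b, c, d⟩; simp [allMC]

/-- certificate check against an explicit pool -/
@[noinline] def certWith (c : MC) (pool : List MC) : Bool :=
  cands.any fun Φ => decide (∃ i j : Idx, Φ i ≠ Φ j) && decide (dotz Φ (vzN c) = 0) &&
    pool.all fun zc => decide (dotz Φ (vzN zc) = 0)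

/-- code-world certificate search -/
def certOKC (c cinv : MC) : Bool := certWith c (allMC.filter fun zc => poolC c cinv zc)

/-- **Pool certificate** (compiled search). -/
theorem fact_certC : ∀ a : Mat, det2 a ≠ 0 → kprop (vc (inv2 a)) (vc a) →
    certOKC (mc a) (mc (inv2 a)) = true := by
  native_decide

/-- **The certificate, in matrix terms.** For every thin invertible `a` there is a non-constant
integer functional killing `vz a` and `vz z` for every `z` in the pool of `a`. -/
theorem cert_exists {a : Mat} (ha : det2 a ≠ 0) (hthin : kprop (vc (inv2 a)) (vc a)) :
    ∃ Φ : Idx → ℤ, (∃ i j : Idx, Φ i ≠ Φ j) ∧ dotz Φ (vz a) = 0 ∧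
      ∀ z : Mat, kprop (vc (mul2 a z)) (vc a) → kprop (vc (mul2 (inv2 a) z)) (vc a) →
        dotz Φ (vz z) = 0 := by
  have h := fact_certC a ha hthin
  have hvc : ∀ g : Mat, vc g = vcN (mc g) := fun g => funext (fact_vc g)
  have hvz : ∀ g : Mat, vz g = vzN (mc g) := fun g => funext fun i => by
    simp only [vz, vzN, fact_vc]
  unfold certOKC certWith at h
  simp only [List.any_eq_true, List.all_eq_true, Bool.and_eq_true, decide_eq_true_eq] at h
  obtain ⟨Φ, -, ⟨hnc, ha0⟩, hpool⟩ := h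
  refine ⟨Φ, hnc, by rw [hvz]; exact ha0, fun z h1 h2 => ?_⟩
  rw [hvz]
  apply hpool (mc z)
  simp only [List.mem_filter, mem_allMC, true_and, poolC, Bool.and_eq_true, kpropB_iff]
  rw [← mc_mul2, ← mc_mul2, ← hvc, ← hvc, ← hvc]
  exact ⟨h1, h2⟩

end Summit.MatrixMultiplication.MatrixMultiplication.Theorems.GradedDesignFamily.Negative.SubfieldNine
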